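import Summits.QuantumFields.YangMills.Theorems.SwapVirialDeficitSigmaBallOffCentreSlab
import Summits.QuantumFields.YangMills.Theorems.SwapVirialDeficitSigmaBallEndSlab
import Summits.QuantumFields.YangMills.Theorems.SwapVirialDeficitSectorLaplaceSmearing
import HarnessLib

/-!
# END-CORE N3: THE SMEARED SLAB/SHELL COMPARISON in the base letters `p = (x₀, y₀)` —
# `∫⁻_{|δ|<s} ∫_p D(p)·w(p)·B₀(δ,p)⁻¹ ≤ (E·900·s^{1/3}(2ρ)^{2/3}/(2ρ)² + s) · ∫_p D(p)·w(p)`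
# (stub `stub_end_gaussCore` of skeleton ➎, memo11 §3 (LEAD sfw-p2 g99): the per-ball comparison and the Tonelli over centres, owner w3 g67;
# free-hands support of ⟨stmt-QuantumFields-24197⟩ `SwapVirialDeficit.SwapGluedStiffness`)

After ✓`lintegral_hubSlab_leader_le` the slab side of hG♭ is `∫⁻_{|δ|<s}∫_p W·w(p)·B₀(δ,p)⁻¹` (`w(p) = (1+x₀²)⁻¹(1+y₀²)⁻¹`), with `W ≤ D(p)` a matched follower factor
that is `E`-constant on base balls of radius `ρ` (w2's leader-distance Lipschitz law); the shell side is `≥ c·∫_p D(p)·w(p)`.  Pointwise the ratio blows up at `p → 0`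
(`∫_{|δ|<s} B₀⁻¹ ≈ π/|p|`), so the comparison is made on BALL AVERAGES (LEAD ✓`lintegral_ball_smear`, sup-metric balls = squares):
✓`slab_integrand_le` splits `w·B₀⁻¹ ≤ ½𝟙_{box}(δ²+|p|²)⁻¹ + ½w`; the second term needs no smearing; the first is smeared over squares of side `2ρ`, bounded per square by
✓`lintegral_offCentre_slab_inv_sum_sq_le` (`72 s^{1/3}(2ρ)^{2/3}`), and only centres within `ρ` of the unit box contribute, where `w ≥ 1/25`.
* `volume_ball_prod_two` (`vol(B_ρ) = (2ρ)²` in `ℝ × ℝ`), `ball_prod_eq_Ioo`, `sigmaSlab_le` (Step 1 in `ℝ≥0∞`), `lintegral_ball_sigmaBox_le` (per square),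
  ★★★ `slab_le_smeared` (the comparison).

HONEST LABEL: elementary measure theory; `stub_end_gaussCore` (N1 w2, N2 w2+✓glue, N3 = this file + ✓OffCentreSlab, N4 assembler) and stubs core-tip ∕ 001-good, ⟨24197⟩ ∕ ⟨24194⟩
and every rung OPEN; own crux ⟨22884⟩ OPEN (blocked-on ⟨19935⟩); the Yang–Mills mass gap is NOT proved; no summit is proved by a line.  THEOREMS ONLY (0 `def`, 0 `sorry`),
standard axioms.  Width seat ym-line-sfw-p2-w3 g67 (cell ym-idea-1, free hands), `--supports stmt-QuantumFields-24197`.  References: [folklore].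
-/

set_option autoImplicit false

noncomputable section

open MeasureTheory Set Real Metric
open scoped ENNReal

namespace Summit.QuantumFields.YangMills.Theorems.SwapVirialDeficit.SigmaBall

open Summit.QuantumFields.YangMills.Theorems.SwapVirialDeficit.SectorLaplace (lintegral_ball_smear)

/-! ## §1 Sup-metric balls of the base plane -/

/-- In `ℝ × ℝ` (sup metric) the ball is the open square: `ball p ρ = Ioo (p.1−ρ) (p.1+ρ) ×ˢ Ioo (p.2−ρ) (p.2+ρ)`. [folklore] -/
theorem ball_prod_eq_Ioo (p : ℝ × ℝ) (ρ : ℝ) : ball p ρ = Ioo (p.1 - ρ) (p.1 + ρ) ×ˢ Ioo (p.2 - ρ) (p.2 + ρ) := by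
  rw [← ball_prod_same, Real.ball_eq_Ioo, Real.ball_eq_Ioo]

/-- `vol(ball 0 ρ) = (2ρ)·(2ρ)` in `ℝ × ℝ` (as `ofReal (2ρ) * ofReal (2ρ)`). [folklore] -/
theorem volume_ball_prod_two (ρ : ℝ) : volume (ball (0 : ℝ × ℝ) ρ) = ENNReal.ofReal (2 * ρ) * ENNReal.ofReal (2 * ρ) := by
  rw [← ball_prod_same, Measure.volume_eq_prod, Measure.prod_prod, Real.volume_ball, Real.volume_ball]

/-! ## §2 Step 1: the pointwise split, integrated in `δ` -/

/-- For `0 < s ≤ 1` and every base point `p`: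
`∫⁻_{|δ|<s} ofReal(w(p)·B₀(δ,p)⁻¹) ≤ ½·∫⁻_{|δ|<s} 𝟙_{box}(p)·ofReal((δ²+|p|²)⁻¹) + ofReal(s·w(p))` (✓`slab_integrand_le`). [folklore] -/
theorem sigmaSlab_le {s : ℝ} (hs0 : 0 < s) (hs1 : s ≤ 1) (p : ℝ × ℝ) :
    ∫⁻ δ in Ioo (-s) s, ENNReal.ofReal ((1 + p.1 ^ 2)⁻¹ * (1 + p.2 ^ 2)⁻¹ *
        (16 * δ ^ 2 / (1 + δ ^ 2) + 8 * p.1 ^ 2 / ((1 + p.1 ^ 2) * (1 + δ ^ 2)) + 4 * p.2 ^ 2 / (1 + p.2 ^ 2))⁻¹) ≤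
      ENNReal.ofReal (1 / 2) * (∫⁻ δ in Ioo (-s) s, (Ioo (-1:ℝ) 1 ×ˢ Ioo (-1:ℝ) 1).indicator (fun q : ℝ × ℝ => ENNReal.ofReal ((δ ^ 2 + q.1 ^ 2 + q.2 ^ 2)⁻¹)) p) +
        ENNReal.ofReal (s * ((1 + p.1 ^ 2)⁻¹ * (1 + p.2 ^ 2)⁻¹)) := by
  have hpt : ∀ δ ∈ Ioo (-s) s, ENNReal.ofReal ((1 + p.1 ^ 2)⁻¹ * (1 + p.2 ^ 2)⁻¹ *
        (16 * δ ^ 2 / (1 + δ ^ 2) + 8 * p.1 ^ 2 / ((1 + p.1 ^ 2) * (1 + δ ^ 2)) + 4 * p.2 ^ 2 / (1 + p.2 ^ 2))⁻¹) ≤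
      ENNReal.ofReal (1 / 2) * (Ioo (-1:ℝ) 1 ×ˢ Ioo (-1:ℝ) 1).indicator (fun q : ℝ × ℝ => ENNReal.ofReal ((δ ^ 2 + q.1 ^ 2 + q.2 ^ 2)⁻¹)) p +
        ENNReal.ofReal ((1 / 2) * ((1 + p.1 ^ 2)⁻¹ * (1 + p.2 ^ 2)⁻¹)) := by
    intro δ hδ
    have hδ1 : δ ^ 2 ≤ 1 := by
      simp only [mem_Ioo] at hδ
      nlinarith [hδ.1, hδ.2]
    have h := slab_integrand_le (x₀ := p.1) (y₀ := p.2) hδ1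
    by_cases hb : p ∈ Ioo (-1:ℝ) 1 ×ˢ Ioo (-1:ℝ) 1
    · rw [Set.indicator_of_mem (show (p.1, p.2) ∈ Ioo (-1:ℝ) 1 ×ˢ Ioo (-1:ℝ) 1 from hb)] at h
      rw [Set.indicator_of_mem hb, ← ENNReal.ofReal_mul (by norm_num), ← ENNReal.ofReal_add (by positivity) (by positivity)]
      exact ENNReal.ofReal_le_ofReal h
    · rw [Set.indicator_of_notMem (show (p.1, p.2) ∉ Ioo (-1:ℝ) 1 ×ˢ Ioo (-1:ℝ) 1 from hb)] at h
      rw [Set.indicator_of_notMem hb, mul_zero, zero_add]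
      exact ENNReal.ofReal_le_ofReal (by linarith)
  have hmeas : Measurable fun δ : ℝ => (Ioo (-1:ℝ) 1 ×ˢ Ioo (-1:ℝ) 1).indicator (fun q : ℝ × ℝ => ENNReal.ofReal ((δ ^ 2 + q.1 ^ 2 + q.2 ^ 2)⁻¹)) p := by
    by_cases hb : p ∈ Ioo (-1:ℝ) 1 ×ˢ Ioo (-1:ℝ) 1
    · simp only [Set.indicator_of_mem hb]; exact Measurable.ennreal_ofReal (by fun_prop)
    · simp only [Set.indicator_of_notMem hb]; exact measurable_const
  calc ∫⁻ δ in Ioo (-s) s, ENNReal.ofReal ((1 + p.1 ^ 2)⁻¹ * (1 + p.2 ^ 2)⁻¹ *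
          (16 * δ ^ 2 / (1 + δ ^ 2) + 8 * p.1 ^ 2 / ((1 + p.1 ^ 2) * (1 + δ ^ 2)) + 4 * p.2 ^ 2 / (1 + p.2 ^ 2))⁻¹)
      ≤ ∫⁻ δ in Ioo (-s) s, (ENNReal.ofReal (1 / 2) * (Ioo (-1:ℝ) 1 ×ˢ Ioo (-1:ℝ) 1).indicator (fun q : ℝ × ℝ => ENNReal.ofReal ((δ ^ 2 + q.1 ^ 2 + q.2 ^ 2)⁻¹)) p +
          ENNReal.ofReal ((1 / 2) * ((1 + p.1 ^ 2)⁻¹ * (1 + p.2 ^ 2)⁻¹))) := setLIntegral_mono' measurableSet_Ioo hpt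
    _ = ENNReal.ofReal (1 / 2) * (∫⁻ δ in Ioo (-s) s, (Ioo (-1:ℝ) 1 ×ˢ Ioo (-1:ℝ) 1).indicator (fun q : ℝ × ℝ => ENNReal.ofReal ((δ ^ 2 + q.1 ^ 2 + q.2 ^ 2)⁻¹)) p) +
          ENNReal.ofReal ((1 / 2) * ((1 + p.1 ^ 2)⁻¹ * (1 + p.2 ^ 2)⁻¹)) * volume (Ioo (-s) s) := by
        rw [lintegral_add_right _ measurable_const, lintegral_const_mul _ hmeas, setLIntegral_const]
    _ = _ := by
        rw [Real.volume_Ioo, ← ENNReal.ofReal_mul (by positivity)]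
        congr 2; ring

/-! ## §3 Step 2: one square -/

/-- Per square: `∫⁻_{p ∈ ball p′ ρ} ∫⁻_{|δ|<s} 𝟙_{box}(p)·(δ²+|p|²)⁻¹ ≤ 72·s^{1/3}(2ρ)^{1/3}(2ρ)^{1/3}` (✓`lintegral_offCentre_slab_inv_sum_sq_le`), and the left side VANISHES
unless the centre is within `ρ` of the unit box. [folklore] -/
theorem lintegral_ball_sigmaBox_le {s ρ : ℝ} (hs : 0 ≤ s) (hρ : 0 ≤ ρ) (p' : ℝ × ℝ) :
    ∫⁻ p in ball p' ρ, ∫⁻ δ in Ioo (-s) s, (Ioo (-1:ℝ) 1 ×ˢ Ioo (-1:ℝ) 1).indicator (fun q : ℝ × ℝ => ENNReal.ofReal ((δ ^ 2 + q.1 ^ 2 + q.2 ^ 2)⁻¹)) p ≤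
      (Ioo (-1 - ρ) (1 + ρ) ×ˢ Ioo (-1 - ρ) (1 + ρ)).indicator (fun _ => ENNReal.ofReal (72 * s ^ (1 / 3 : ℝ) * (2 * ρ) ^ (1 / 3 : ℝ) * (2 * ρ) ^ (1 / 3 : ℝ))) p' := by
  by_cases hp' : p' ∈ Ioo (-1 - ρ) (1 + ρ) ×ˢ Ioo (-1 - ρ) (1 + ρ)
  · rw [Set.indicator_of_mem hp']
    have hF : Measurable fun q : ℝ × (ℝ × ℝ) => ENNReal.ofReal ((q.1 ^ 2 + q.2.1 ^ 2 + q.2.2 ^ 2)⁻¹) := Measurable.ennreal_ofReal (by fun_prop)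
    have key : ∫⁻ q in (Ioo (-s) s) ×ˢ (Ioo (p'.1 - ρ) (p'.1 + ρ) ×ˢ Ioo (p'.2 - ρ) (p'.2 + ρ)), ENNReal.ofReal ((q.1 ^ 2 + q.2.1 ^ 2 + q.2.2 ^ 2)⁻¹)
          ∂(volume : Measure (ℝ × ℝ × ℝ)) =
        ∫⁻ p in Ioo (p'.1 - ρ) (p'.1 + ρ) ×ˢ Ioo (p'.2 - ρ) (p'.2 + ρ), ∫⁻ δ in Ioo (-s) s, ENNReal.ofReal ((δ ^ 2 + p.1 ^ 2 + p.2 ^ 2)⁻¹) := by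
      rw [Measure.volume_eq_prod]
      exact setLIntegral_prod_symm _ hF.aemeasurable
    calc ∫⁻ p in ball p' ρ, ∫⁻ δ in Ioo (-s) s, (Ioo (-1:ℝ) 1 ×ˢ Ioo (-1:ℝ) 1).indicator (fun q : ℝ × ℝ => ENNReal.ofReal ((δ ^ 2 + q.1 ^ 2 + q.2 ^ 2)⁻¹)) p
        ≤ ∫⁻ p in ball p' ρ, ∫⁻ δ in Ioo (-s) s, ENNReal.ofReal ((δ ^ 2 + p.1 ^ 2 + p.2 ^ 2)⁻¹) :=
          lintegral_mono fun p => lintegral_mono fun δ => Set.indicator_le_self _ (fun q : ℝ × ℝ => ENNReal.ofReal ((δ ^ 2 + q.1 ^ 2 + q.2 ^ 2)⁻¹)) p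
      _ = ∫⁻ q in (Ioo (-s) s) ×ˢ (Ioo (p'.1 - ρ) (p'.1 + ρ) ×ˢ Ioo (p'.2 - ρ) (p'.2 + ρ)), ENNReal.ofReal ((q.1 ^ 2 + q.2.1 ^ 2 + q.2.2 ^ 2)⁻¹)
          ∂(volume : Measure (ℝ × ℝ × ℝ)) := by rw [ball_prod_eq_Ioo, key]
      _ ≤ _ := by
          have h := lintegral_offCentre_slab_inv_sum_sq_le (ℓ := 2 * ρ) hs (by linarith) (p'.1 - ρ) (p'.2 - ρ)
          rwa [show p'.1 - ρ + 2 * ρ = p'.1 + ρ by ring, show p'.2 - ρ + 2 * ρ = p'.2 + ρ by ring] at h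
  · rw [Set.indicator_of_notMem hp']
    refine le_of_eq ((setLIntegral_congr_fun measurableSet_ball fun p hp => ?_).trans lintegral_zero)
    have hpb : p ∉ Ioo (-1:ℝ) 1 ×ˢ Ioo (-1:ℝ) 1 := by
      intro hb
      apply hp'
      rw [ball_prod_eq_Ioo] at hp
      obtain ⟨⟨h1, h2⟩, ⟨h3, h4⟩⟩ := hp
      obtain ⟨⟨b1, b2⟩, ⟨b3, b4⟩⟩ := hb
      exact ⟨⟨by linarith, by linarith⟩, ⟨by linarith, by linarith⟩⟩
    simp only [Set.indicator_of_notMem hpb, lintegral_zero]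

/-! ## §4 The smeared comparison -/

/-- ★★★ **THE SMEARED SLAB ∕ SHELL COMPARISON** (memo11 §3).  Let `0 < s ≤ 1`, `0 < ρ ≤ 1`, and let `D ≥ 0` be measurable on the base plane and `E`-constant on
sup-metric balls of radius `ρ` (`dist p p′ < ρ ⟹ D p ≤ E·D p′`).  Then, with `w(p) = (1+x₀²)⁻¹(1+y₀²)⁻¹` and LEAD's `B₀`,
`∫⁻_{(δ,p) ∈ (−s,s)×ℝ²} D(p)·ofReal(w(p)·B₀(δ,p)⁻¹) ≤ (E·ofReal(900·s^{1/3}(2ρ)^{1/3}(2ρ)^{1/3}·((2ρ)(2ρ))⁻¹) + ofReal s) · ∫⁻_p D(p)·ofReal(w(p))`. [folklore] -/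
theorem slab_le_smeared {s ρ : ℝ} (hs0 : 0 < s) (hs1 : s ≤ 1) (hρ0 : 0 < ρ) (hρ1 : ρ ≤ 1) {E : ℝ≥0∞} (D : ℝ × ℝ → ℝ≥0∞) (hDm : Measurable D)
    (hD : ∀ p p' : ℝ × ℝ, dist p p' < ρ → D p ≤ E * D p') :
    ∫⁻ q in (Ioo (-s) s) ×ˢ (univ : Set (ℝ × ℝ)), D q.2 * ENNReal.ofReal ((1 + q.2.1 ^ 2)⁻¹ * (1 + q.2.2 ^ 2)⁻¹ *
        (16 * q.1 ^ 2 / (1 + q.1 ^ 2) + 8 * q.2.1 ^ 2 / ((1 + q.2.1 ^ 2) * (1 + q.1 ^ 2)) + 4 * q.2.2 ^ 2 / (1 + q.2.2 ^ 2))⁻¹)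
        ∂(volume : Measure (ℝ × ℝ × ℝ)) ≤
      (E * ENNReal.ofReal (900 * s ^ (1 / 3 : ℝ) * (2 * ρ) ^ (1 / 3 : ℝ) * (2 * ρ) ^ (1 / 3 : ℝ) * ((2 * ρ) * (2 * ρ))⁻¹) + ENNReal.ofReal s) *
        ∫⁻ p : ℝ × ℝ, D p * ENNReal.ofReal ((1 + p.1 ^ 2)⁻¹ * (1 + p.2 ^ 2)⁻¹) := by
  -- abbreviations
  set box : Set (ℝ × ℝ) := Ioo (-1:ℝ) 1 ×ˢ Ioo (-1:ℝ) 1 with hbox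
  set Φ : ℝ × ℝ → ℝ≥0∞ := fun p => ∫⁻ δ in Ioo (-s) s, box.indicator (fun q : ℝ × ℝ => ENNReal.ofReal ((δ ^ 2 + q.1 ^ 2 + q.2 ^ 2)⁻¹)) p with hΦ
  set w : ℝ × ℝ → ℝ≥0∞ := fun p => ENNReal.ofReal ((1 + p.1 ^ 2)⁻¹ * (1 + p.2 ^ 2)⁻¹) with hw
  set Z : ℝ := 72 * s ^ (1 / 3 : ℝ) * (2 * ρ) ^ (1 / 3 : ℝ) * (2 * ρ) ^ (1 / 3 : ℝ) with hZ
  have hZ0 : 0 ≤ Z := by rw [hZ]; positivity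
  have hwm : Measurable w := by rw [hw]; exact Measurable.ennreal_ofReal (by fun_prop)
  have hΦm : Measurable Φ := by
    rw [hΦ]
    have h2 : Measurable (Function.uncurry fun (p : ℝ × ℝ) (δ : ℝ) => box.indicator (fun q : ℝ × ℝ => ENNReal.ofReal ((δ ^ 2 + q.1 ^ 2 + q.2 ^ 2)⁻¹)) p) := by
      have e : (Function.uncurry fun (p : ℝ × ℝ) (δ : ℝ) => box.indicator (fun q : ℝ × ℝ => ENNReal.ofReal ((δ ^ 2 + q.1 ^ 2 + q.2 ^ 2)⁻¹)) p) =
          (box ×ˢ (univ : Set ℝ)).indicator (fun r : (ℝ × ℝ) × ℝ => ENNReal.ofReal ((r.2 ^ 2 + r.1.1 ^ 2 + r.1.2 ^ 2)⁻¹)) := by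
        funext r
        by_cases hr : r.1 ∈ box
        · simp [Function.uncurry, Set.indicator_of_mem hr, Set.indicator_of_mem (show r ∈ box ×ˢ (univ : Set ℝ) from ⟨hr, mem_univ _⟩)]
        · simp [Function.uncurry, Set.indicator_of_notMem hr, Set.indicator_of_notMem (show r ∉ box ×ˢ (univ : Set ℝ) from fun h => hr h.1)]
      rw [e]
      exact (Measurable.ennreal_ofReal (by fun_prop)).indicator ((measurableSet_Ioo.prod measurableSet_Ioo).prod MeasurableSet.univ)
    exact h2.lintegral_prod_right
  -- Step A: Tonelli, `p` outside, and the pointwise split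
  have hG : Measurable fun q : ℝ × (ℝ × ℝ) => D q.2 * ENNReal.ofReal ((1 + q.2.1 ^ 2)⁻¹ * (1 + q.2.2 ^ 2)⁻¹ *
      (16 * q.1 ^ 2 / (1 + q.1 ^ 2) + 8 * q.2.1 ^ 2 / ((1 + q.2.1 ^ 2) * (1 + q.1 ^ 2)) + 4 * q.2.2 ^ 2 / (1 + q.2.2 ^ 2))⁻¹) :=
    (hDm.comp measurable_snd).mul (Measurable.ennreal_ofReal (by fun_prop))
  have stepA : ∫⁻ q in (Ioo (-s) s) ×ˢ (univ : Set (ℝ × ℝ)), D q.2 * ENNReal.ofReal ((1 + q.2.1 ^ 2)⁻¹ * (1 + q.2.2 ^ 2)⁻¹ *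
        (16 * q.1 ^ 2 / (1 + q.1 ^ 2) + 8 * q.2.1 ^ 2 / ((1 + q.2.1 ^ 2) * (1 + q.1 ^ 2)) + 4 * q.2.2 ^ 2 / (1 + q.2.2 ^ 2))⁻¹)
        ∂(volume : Measure (ℝ × ℝ × ℝ)) ≤
      ∫⁻ p : ℝ × ℝ, D p * (ENNReal.ofReal (1 / 2) * Φ p + ENNReal.ofReal s * w p) := by
    rw [Measure.volume_eq_prod, setLIntegral_prod_symm _ hG.aemeasurable, Measure.restrict_univ]
    refine lintegral_mono fun p => ?_
    show ∫⁻ x in Ioo (-s) s, D p * ENNReal.ofReal ((1 + p.1 ^ 2)⁻¹ * (1 + p.2 ^ 2)⁻¹ *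
        (16 * x ^ 2 / (1 + x ^ 2) + 8 * p.1 ^ 2 / ((1 + p.1 ^ 2) * (1 + x ^ 2)) + 4 * p.2 ^ 2 / (1 + p.2 ^ 2))⁻¹) ≤ _
    have hm : Measurable fun x : ℝ => ENNReal.ofReal ((1 + p.1 ^ 2)⁻¹ * (1 + p.2 ^ 2)⁻¹ *
        (16 * x ^ 2 / (1 + x ^ 2) + 8 * p.1 ^ 2 / ((1 + p.1 ^ 2) * (1 + x ^ 2)) + 4 * p.2 ^ 2 / (1 + p.2 ^ 2))⁻¹) := Measurable.ennreal_ofReal (by fun_prop)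
    rw [lintegral_const_mul _ hm]
    refine mul_le_mul_right ?_ _
    have h := sigmaSlab_le hs0 hs1 p
    rw [hΦ, hw, ← ENNReal.ofReal_mul hs0.le]
    exact h
  -- Step B: the `s·w` part needs no smearing; the Σ part is smeared
  have hsmear := lintegral_ball_smear (volume : Measure (ℝ × ℝ)) ρ (fun p => D p * Φ p) (hDm.mul hΦm)
  have hball : volume (ball (0 : ℝ × ℝ) ρ) = ENNReal.ofReal ((2 * ρ) * (2 * ρ)) := by
    rw [volume_ball_prod_two, ← ENNReal.ofReal_mul (by positivity)]
  -- per centre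
  have hcentre : ∀ p' : ℝ × ℝ, ∫⁻ p in ball p' ρ, D p * Φ p ≤ E * (ENNReal.ofReal 25 * (w p' * D p')) * ENNReal.ofReal Z := by
    intro p'
    calc ∫⁻ p in ball p' ρ, D p * Φ p ≤ ∫⁻ p in ball p' ρ, E * D p' * Φ p := by
          refine setLIntegral_mono' measurableSet_ball fun p hp => ?_
          exact mul_le_mul_left (hD p p' (mem_ball.1 hp)) _
      _ = E * D p' * ∫⁻ p in ball p' ρ, Φ p := by rw [lintegral_const_mul _ hΦm]
      _ ≤ E * D p' * (Ioo (-1 - ρ) (1 + ρ) ×ˢ Ioo (-1 - ρ) (1 + ρ)).indicator (fun _ => ENNReal.ofReal Z) p' :=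
          mul_le_mul_right (by rw [hΦ, hZ]; exact lintegral_ball_sigmaBox_le hs0.le hρ0.le p') _
      _ ≤ E * (ENNReal.ofReal 25 * (w p' * D p')) * ENNReal.ofReal Z := by
          by_cases hp' : p' ∈ Ioo (-1 - ρ) (1 + ρ) ×ˢ Ioo (-1 - ρ) (1 + ρ)
          · rw [Set.indicator_of_mem hp']
            have hw25 : (1 : ℝ≥0∞) ≤ ENNReal.ofReal 25 * w p' := by
              rw [hw, ← ENNReal.ofReal_mul (by norm_num), ← ENNReal.ofReal_one]
              refine ENNReal.ofReal_le_ofReal ?_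
              obtain ⟨⟨h1, h2⟩, ⟨h3, h4⟩⟩ := hp'
              have a1 : p'.1 ^ 2 < 4 := by nlinarith
              have a2 : p'.2 ^ 2 < 4 := by nlinarith
              rw [← one_div, ← one_div, show (25 : ℝ) * (1 / (1 + p'.1 ^ 2) * (1 / (1 + p'.2 ^ 2))) = 25 / ((1 + p'.1 ^ 2) * (1 + p'.2 ^ 2)) by field_simp,
                le_div_iff₀ (by positivity)]
              nlinarith [sq_nonneg p'.1, sq_nonneg p'.2, mul_nonneg (sq_nonneg p'.1) (sq_nonneg p'.2)]
            calc E * D p' * ENNReal.ofReal Z = E * (1 * D p') * ENNReal.ofReal Z := by rw [one_mul]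
              _ ≤ E * (ENNReal.ofReal 25 * w p' * D p') * ENNReal.ofReal Z := by gcongr
              _ = _ := by ring
          · rw [Set.indicator_of_notMem hp', mul_zero]; exact bot_le
  have stepB : ENNReal.ofReal ((2 * ρ) * (2 * ρ)) * ∫⁻ p, D p * Φ p ≤ E * ENNReal.ofReal 25 * ENNReal.ofReal Z * ∫⁻ p, w p * D p := by
    rw [← hball, hsmear]
    calc ∫⁻ p', ∫⁻ p in ball p' ρ, D p * Φ p ≤ ∫⁻ p', E * (ENNReal.ofReal 25 * (w p' * D p')) * ENNReal.ofReal Z := lintegral_mono hcentre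
      _ = E * ENNReal.ofReal 25 * ENNReal.ofReal Z * ∫⁻ p, w p * D p := by
          have e : ∀ p', E * (ENNReal.ofReal 25 * (w p' * D p')) * ENNReal.ofReal Z = (E * ENNReal.ofReal 25 * ENNReal.ofReal Z) * (w p' * D p') := fun p' => by ring
          simp_rw [e]
          rw [lintegral_const_mul (f := fun p : ℝ × ℝ => w p * D p) _ (hwm.mul hDm)]
  -- Step C: divide by the ball volume
  have hvol0 : ENNReal.ofReal ((2 * ρ) * (2 * ρ)) ≠ 0 := by rw [ENNReal.ofReal_ne_zero_iff]; positivity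
  have stepC : ∫⁻ p, D p * Φ p ≤ ENNReal.ofReal (((2 * ρ) * (2 * ρ))⁻¹) * (E * ENNReal.ofReal 25 * ENNReal.ofReal Z * ∫⁻ p, w p * D p) := by
    have hinv : ENNReal.ofReal (((2 * ρ) * (2 * ρ))⁻¹) * ENNReal.ofReal ((2 * ρ) * (2 * ρ)) = 1 := by
      rw [← ENNReal.ofReal_mul (by positivity), inv_mul_cancel₀ (by positivity), ENNReal.ofReal_one]
    calc ∫⁻ p, D p * Φ p = ENNReal.ofReal (((2 * ρ) * (2 * ρ))⁻¹) * (ENNReal.ofReal ((2 * ρ) * (2 * ρ)) * ∫⁻ p, D p * Φ p) := by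
          rw [← mul_assoc, hinv, one_mul]
      _ ≤ _ := mul_le_mul_right stepB _
  -- assemble
  have hsplit : ∫⁻ p : ℝ × ℝ, D p * (ENNReal.ofReal (1 / 2) * Φ p + ENNReal.ofReal s * w p) =
      ENNReal.ofReal (1 / 2) * (∫⁻ p, D p * Φ p) + ENNReal.ofReal s * (∫⁻ p, D p * w p) := by
    have e : ∀ p, D p * (ENNReal.ofReal (1 / 2) * Φ p + ENNReal.ofReal s * w p) = ENNReal.ofReal (1 / 2) * (D p * Φ p) + ENNReal.ofReal s * (D p * w p) :=
      fun p => by ring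
    simp_rw [e]
    rw [lintegral_add_left (f := fun p : ℝ × ℝ => ENNReal.ofReal (1 / 2) * (D p * Φ p)) ((hDm.mul hΦm).const_mul _),
      lintegral_const_mul (f := fun p : ℝ × ℝ => D p * Φ p) _ (hDm.mul hΦm), lintegral_const_mul (f := fun p : ℝ × ℝ => D p * w p) _ (hDm.mul hwm)]
  have ewD : ∫⁻ p, w p * D p = ∫⁻ p, D p * w p := lintegral_congr fun p => mul_comm _ _
  calc _ ≤ ∫⁻ p : ℝ × ℝ, D p * (ENNReal.ofReal (1 / 2) * Φ p + ENNReal.ofReal s * w p) := stepA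
    _ = ENNReal.ofReal (1 / 2) * (∫⁻ p, D p * Φ p) + ENNReal.ofReal s * (∫⁻ p, D p * w p) := hsplit
    _ ≤ ENNReal.ofReal (1 / 2) * (ENNReal.ofReal (((2 * ρ) * (2 * ρ))⁻¹) * (E * ENNReal.ofReal 25 * ENNReal.ofReal Z * ∫⁻ p, w p * D p)) +
          ENNReal.ofReal s * (∫⁻ p, D p * w p) := add_le_add (mul_le_mul_right stepC _) le_rfl
    _ = (E * ENNReal.ofReal (900 * s ^ (1 / 3 : ℝ) * (2 * ρ) ^ (1 / 3 : ℝ) * (2 * ρ) ^ (1 / 3 : ℝ) * ((2 * ρ) * (2 * ρ))⁻¹) + ENNReal.ofReal s) *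
          ∫⁻ p : ℝ × ℝ, D p * w p := by
        rw [ewD, add_mul]
        congr 1
        have e1 : ENNReal.ofReal (1 / 2) * (ENNReal.ofReal (((2 * ρ) * (2 * ρ))⁻¹) * (E * ENNReal.ofReal 25 * ENNReal.ofReal Z * ∫⁻ p, D p * w p)) =
            E * (ENNReal.ofReal (1 / 2) * ENNReal.ofReal (((2 * ρ) * (2 * ρ))⁻¹) * ENNReal.ofReal 25 * ENNReal.ofReal Z) * ∫⁻ p, D p * w p := by ring
        rw [e1, ← ENNReal.ofReal_mul (by norm_num), ← ENNReal.ofReal_mul (by positivity), ← ENNReal.ofReal_mul (by positivity)]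
        congr 3
        rw [hZ]; ring

end Summit.QuantumFields.YangMills.Theorems.SwapVirialDeficit.SigmaBall

end
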